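/-
Copyright (c) 2026 the pub-hodgecm-mathlib formalisation cell (harness21).  Prover seat hodgecm-mathlib-K2E3-p21 (g6), Track B «K2-LIT» ∕ h413
(`stmt-HodgeConjecture-24833`), line `K2_E3_EllipticInputs`, leaf (nsc-S-A′), H-layer brick LEV-1 (sequel) of `MEMO-H4-residues.v1.K2E3-p25-g0.md` §1 (architect
K2E3-p25 (g0); dealer K2E3-plan (g4) RULINGS #3 (R-9) D76).  2026-09-04.
-/
import Summits.HodgeConjecture.HodgeConjecture.Theorems.K2E3TwistedCoinvariantsSeparation   -- LEV-1 (this seat): `eq_zero_of_forall_mem_ker_coinvariants_twist`, `…_charTwist`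
import HarnessLib

/-!
# Crux `H413` — K2-LIT E3, H-layer brick LEV-1 (sequel): separation by twisted coinvariants in the `IsLimitOfCompactOpen` frame

Cell `hodgecm-mathlib`, Track B, line `K2_E3_EllipticInputs`, leaf (nsc-S-A′), H-layer rule (lev) (architect K2E3-p25 (g0), `MEMO-H4-residues.v1` §1).  LEV-1
`K2E3TwistedCoinvariantsSeparation` states separation for an abelian group exhausted by a MONOTONE SEQUENCE `K₀ ≤ K₁ ≤ ⋯` of compact open subgroups.  The tree's
unipotent subgroups come instead with ★ `IsLimitOfCompactOpen` («every compact set lies in a compact open subgroup»: ★ `isLimitOfCompactOpen_unipotentRadicalGL`,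
★ `isLimitOfCompactOpen_upperUnitriangular`, ★ `isLimitOfCompactOpen_subgroupOf`, …) and are σ-compact (closed in the second-countable locally compact `GL₃(F)`).
This sequel bridges the two frames.  THEOREMS ONLY; count-neutral helper (`--supports stmt-HodgeConjecture-24833 --as helper`).

* §1 `exists_monotone_compactOpen_exhaustion` — a σ-compact group with `IsLimitOfCompactOpen` has a monotone exhaustion by compact open subgroups (recursively: `Kₙ₊₁` a
  compact open subgroup containing `compactCovering (n+1) ∪ Kₙ`).
* §2 **`eq_zero_of_forall_mem_ker_coinvariants_twist_of_isLimitOfCompactOpen`** (abelian `N`, σ-compact, `IsLimitOfCompactOpen N`) and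
  **`eq_zero_of_forall_mem_ker_charTwist_of_isLimitOfCompactOpen`** (abelian subgroup `U ≤ G`, `IsLimitOfCompactOpen ↥U`, `U` closed in a σ-compact `G`; the
  `θ`-localisations `(ρ.charTwist U θ).Coinvariants` of ★ `WhittakerTwistedJacquet`) — the shapes rule (lev) (LEV-3 `K2E3GL3DegenerateLevelOne`) consumes for the
  root subgroups `U_{α₁} ≅ F`, `U_Q ≅ F²` of `GL₃(F)`.

HONEST LABEL: HC_CM is proved only modulo the 7 printed citations (2 remaining named inputs: hLiu418 = stmt-HodgeConjecture-24832, h413 =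
stmt-HodgeConjecture-24833) until rung 0 closes; elementary, closes no organ by itself.

## References
* [BernsteinZelevinsky1976] I. N. Bernstein, A. V. Zelevinsky, *Representations of the group GL(n,F) where F is a non-archimedean local field*, Russian Math.
  Surveys 31:3 (1976), §1.1 (l-groups), §2.30–§2.36 (the functor `r_{U,θ}`).
* [BernsteinZelevinskyASENS1977] I. N. Bernstein, A. V. Zelevinsky, *Induced representations of reductive p-adic groups I*, Ann. Sci. ÉNS 10 (1977), §1.8–1.9.
-/

set_option autoImplicit false
-- the mandated namespace repeats `HodgeConjecture.HodgeConjecture`, as in every `Theorems/*.lean` of this sub-problem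
set_option linter.dupNamespace false

noncomputable section

open Representation
open Literature.NumberTheory.Automorphic

namespace Summit.HodgeConjecture.HodgeConjecture.Cruxes.H413.K2E3TwistedCoinvariantsSeparation

/-! ## §1  A monotone exhaustion by compact open subgroups -/

/-- **A σ-compact group in which every compact set lies in a compact open subgroup (`IsLimitOfCompactOpen`) is exhausted by a MONOTONE sequence of compact open
subgroups** (`Kₙ₊₁ ⊇ compactCovering (n+1) ∪ Kₙ`). [cite: BernsteinZelevinsky1976, §1.1] -/
theorem exists_monotone_compactOpen_exhaustion {N : Type*} [Group N] [TopologicalSpace N] [SigmaCompactSpace N] (h : IsLimitOfCompactOpen N) :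
    ∃ K : ℕ → Subgroup N, Monotone K ∧ (∀ n, IsOpen (K n : Set N)) ∧ (∀ n, IsCompact (K n : Set N)) ∧ ∀ x, ∃ n, x ∈ K n := by
  classical
  choose Ks hKo hKc hKsub using h
  -- the recursion, carrying the compactness of the previous stage
  let Kc : ℕ → {K : Subgroup N // IsCompact (K : Set N)} := fun n =>
    Nat.rec (motive := fun _ => {K : Subgroup N // IsCompact (K : Set N)})
      ⟨Ks (compactCovering N 0) (isCompact_compactCovering N 0), hKc _ _⟩
      (fun n prev => ⟨Ks (compactCovering N (n + 1) ∪ (prev.1 : Set N)) ((isCompact_compactCovering N (n + 1)).union prev.2), hKc _ _⟩) n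
  have hsucc : ∀ n, (Kc (n + 1)).1 = Ks (compactCovering N (n + 1) ∪ ((Kc n).1 : Set N)) ((isCompact_compactCovering N (n + 1)).union (Kc n).2) := fun n => rfl
  have hzero : (Kc 0).1 = Ks (compactCovering N 0) (isCompact_compactCovering N 0) := rfl
  refine ⟨fun n => (Kc n).1, ?_, fun n => ?_, fun n => (Kc n).2, fun x => ?_⟩
  · refine monotone_nat_of_le_succ fun n => ?_
    intro x hx
    have hx' : x ∈ compactCovering N (n + 1) ∪ ((Kc n).1 : Set N) := Or.inr hx
    have h2 := hKsub _ ((isCompact_compactCovering N (n + 1)).union (Kc n).2) hx'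
    rw [← hsucc n] at h2
    exact h2
  · show IsOpen ((Kc n).1 : Set N)
    rcases n with _ | n
    · rw [hzero]; exact hKo _ _
    · rw [hsucc n]; exact hKo _ _
  · obtain ⟨n, hn⟩ := exists_mem_compactCovering x
    refine ⟨n, ?_⟩
    show x ∈ (Kc n).1
    rcases n with _ | n
    · rw [hzero]; exact hKsub _ _ hn
    · have h2 := hKsub _ ((isCompact_compactCovering N (n + 1)).union (Kc n).2) (Or.inl hn)
      rw [← hsucc n] at h2
      exact h2

/-! ## §2  Separation in the `IsLimitOfCompactOpen` frame -/

/-- **LEV-1 in the `IsLimitOfCompactOpen` frame**: `N` abelian, σ-compact, every compact set inside a compact open subgroup, `τ` smooth; a vector dying in the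
`ψ`-twisted coinvariants `Coinvariants.ker (τ.twist ψ⁻¹)` for EVERY character `ψ : N → ℂ^×` with open kernel is `0`.
[cite: BernsteinZelevinsky1976, §2.33] [cite: BernsteinZelevinskyASENS1977, §1.8] -/
theorem eq_zero_of_forall_mem_ker_coinvariants_twist_of_isLimitOfCompactOpen {N : Type*} [CommGroup N] [TopologicalSpace N] [IsTopologicalGroup N]
    [SigmaCompactSpace N] (hN : IsLimitOfCompactOpen N) {V : Type*} [AddCommGroup V] [Module ℂ V] (τ : Representation ℂ N V) (hτ : τ.IsSmooth)
    {v : V} (hv : ∀ ψ : N →* ℂˣ, IsOpen (ψ.ker : Set N) → v ∈ Coinvariants.ker (τ.twist ψ⁻¹)) : v = 0 := by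
  obtain ⟨K, hKmono, hKo, hKc, hKcov⟩ := exists_monotone_compactOpen_exhaustion hN
  exact eq_zero_of_forall_mem_ker_coinvariants_twist τ hτ K hKmono hKo hKc hKcov hv

/-- **LEV-1 for an abelian subgroup in the `IsLimitOfCompactOpen` ∕ `charTwist` frame** (the shape rule (lev) uses for the root subgroups `U_{α₁} ≅ F`, `U_Q ≅ F²` of
`GL₃(F)`: ★ `isLimitOfCompactOpen_unipotentRadicalGL` ∕ `isLimitOfCompactOpen_subgroupOf` supply `hUl`): `ρ` smooth on `G`, `U ≤ G` abelian and σ-compact with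
`IsLimitOfCompactOpen ↥U`; a vector dying in `(ρ.charTwist U θ).Coinvariants` for EVERY character `θ : U → ℂ^×` with open kernel is `0`.
[cite: BernsteinZelevinsky1976, §2.33] [cite: BernsteinZelevinskyASENS1977, §1.8] -/
theorem eq_zero_of_forall_mem_ker_charTwist_of_isLimitOfCompactOpen {G : Type*} [Group G] [TopologicalSpace G] [IsTopologicalGroup G]
    {W : Type*} [AddCommGroup W] [Module ℂ W] (ρ : Representation ℂ G W) (hρ : ρ.IsSmooth)
    (U : Subgroup G) (hU : ∀ x y : ↥U, x * y = y * x) [SigmaCompactSpace ↥U] (hUl : IsLimitOfCompactOpen ↥U)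
    {v : W} (hv : ∀ θ : ↥U →* ℂˣ, IsOpen (θ.ker : Set ↥U) → v ∈ Coinvariants.ker (ρ.charTwist U θ)) : v = 0 := by
  obtain ⟨K, hKmono, hKo, hKc, hKcov⟩ := exists_monotone_compactOpen_exhaustion hUl
  exact eq_zero_of_forall_mem_ker_charTwist ρ hρ U hU K hKmono hKo hKc hKcov hv

/-- The same for a CLOSED abelian subgroup of a σ-compact group (σ-compactness of `↥U` from Mathlib `IsClosed.sigmaCompactSpace`).
[cite: BernsteinZelevinsky1976, §2.33] -/
theorem eq_zero_of_forall_mem_ker_charTwist_of_isClosed {G : Type*} [Group G] [TopologicalSpace G] [IsTopologicalGroup G] [SigmaCompactSpace G]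
    {W : Type*} [AddCommGroup W] [Module ℂ W] (ρ : Representation ℂ G W) (hρ : ρ.IsSmooth)
    (U : Subgroup G) (hU : ∀ x y : ↥U, x * y = y * x) (hUc : IsClosed (U : Set G)) (hUl : IsLimitOfCompactOpen ↥U)
    {v : W} (hv : ∀ θ : ↥U →* ℂˣ, IsOpen (θ.ker : Set ↥U) → v ∈ Coinvariants.ker (ρ.charTwist U θ)) : v = 0 := by
  haveI : SigmaCompactSpace ↥U := hUc.sigmaCompactSpace
  exact eq_zero_of_forall_mem_ker_charTwist_of_isLimitOfCompactOpen ρ hρ U hU hUl hv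

end Summit.HodgeConjecture.HodgeConjecture.Cruxes.H413.K2E3TwistedCoinvariantsSeparation

end
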